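import Summits.AtomisticToContinuum.BoseEinsteinCondensation.Theorems.BECGroundStateSOSPeriodicIRBoundDefs
import Summits.AtomisticToContinuum.BoseEinsteinCondensation.Theorems.BECGroundStateSOSPeriodicIRBoundWFDefs
import Summits.AtomisticToContinuum.BoseEinsteinCondensation.Theorems.BECGroundStateSOSPeriodicIRBoundWFHeartKin
import Literature.MathematicalPhysics.QuantumManyBody.PeriodicBoseGasMomentumSector
import Literature.MathematicalPhysics.QuantumManyBody.TorusFockLayer
import Literature.MathematicalPhysics.QuantumManyBody.TorusFockSectorInteraction
import Literature.MathematicalPhysics.QuantumManyBody.PeriodicFormDomain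
import Literature.MathematicalPhysics.QuantumManyBody.PeriodicFeynmanKacCell
import HarnessLib

/-! # Crux `PeriodicIRBound` (stmt-AtomisticToContinuum-3972), line `linear-ph-floor-wagner`, stub 5b `stub_wagnerFeynman` — HeartKin2
The kinetic Wagner–Feynman identity, part 2: `T[a_pΦ] + T[a_p†Φ] = |p|²‖Φ‖² + T[Φ] + 2K`, and the kinetic cross term `Re B_0(Φ, n̂_pΦ) = K` through the modes. -/

/-!
# Stub 5b (`stub_wagnerFeynman`), §D-kin: the kinetic Wagner–Feynman identity through the modes

(K2), the kinetic Parseval `∫|∇g|² = ∑_q |q|² ‖a_q g‖²` for UNNORMALISED core functions (K3, by scaling the tree's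
trial-state version), then the identity
`T[aΦ] + T[a†Φ] = ‖p‖²‖Φ‖² + T[Φ] + 2·(‖p‖² n_p(Φ) + ∑_q |q|² ‖a_p a_q Φ‖²)` (D-kin).
-/

noncomputable section

open scoped BigOperators ENNReal ComplexConjugate Topology
open Filter MeasureTheory

namespace Summit.AtomisticToContinuum.BoseEinsteinCondensation.Cruxes.PeriodicIRBound.LinearPhFloorWagner.WF

open Literature.MathematicalPhysics.QuantumManyBody.BoseGas

variable {M m n : ℕ} {L : ℝ}

/-! ### The kinetic Wagner–Feynman identity -/

/-- `∑_q ε_q [q = p] c = ε_p c`. [folklore] -/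
theorem tsum_eps_ite (L : ℝ) (p : Fin 3 → ℤ) (c : ℝ≥0∞) :
    ∑' q : Fin 3 → ℤ, eps L q * (if q = p then c else 0) = eps L p * c := by
  rw [tsum_eq_single p]
  · simp
  · intro q hq
    simp [hq]

/-- **The kinetic Wagner–Feynman identity.** For a core `(n+2)`-body `Φ` and a mode `p`,
`T[a_pΦ] + T[a_p†Φ] = ε_p‖Φ‖² + T[Φ] + 2(ε_p N_p(Φ) + ∑_q ε_q ‖a_p a_q Φ‖²)`, `T[g] = ∫_{cell}|∇g|²`
(`[a_p,[T,a_p†]] = ε_p`; all terms in `ℝ≥0∞`, no finiteness needed). [cite: LSSY2005, App. A (A.6)–(A.7)] -/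
theorem kinetic_wagnerFeynman (hL : 0 < L) (p : Fin 3 → ℤ) {Φ : Config (n + 2) → ℂ} (hΦ : IsCore L Φ) :
    (∫⁻ Y in cellN (n + 1) L, kineticDensity (modeAn L (planeWaveMode L p) Φ) Y) +
      ∫⁻ Z in cellN (n + 3) L, kineticDensity (modeCr (planeWaveMode L p) Φ) Z =
    eps L p * normSq L Φ + (∫⁻ X in cellN (n + 2) L, kineticDensity Φ X) +
      2 * (eps L p * occ L p Φ + ∑' q : Fin 3 → ℤ, eps L q * normSq L
        (modeAn L (planeWaveMode L p) (modeAn L (planeWaveMode L q) Φ))) := by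
  have hpΦ : IsCore L (modeAn L (planeWaveMode L p) Φ) := isCore_modeAn hL p hΦ
  have hcΦ : IsCore L (modeCr (planeWaveMode L p) Φ) := isCore_modeCr hL p hΦ
  -- the three kinetic energies through the modes
  rw [lintegral_kineticDensity_eq_tsum_normSq_modeAn hL hpΦ, lintegral_kineticDensity_eq_tsum_normSq_modeAn hL hcΦ,
    lintegral_kineticDensity_eq_tsum_normSq_modeAn hL hΦ]
  simp only [show ∀ q, ENNReal.ofReal (‖waveVector L q‖ ^ 2) = eps L q from fun q => rfl]
  -- per-mode occupations of `a_p Φ` (commute) and of `a_p† Φ` (CCR)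
  have h1 : ∀ q, normSq L (modeAn L (planeWaveMode L q) (modeAn L (planeWaveMode L p) Φ)) =
      normSq L (modeAn L (planeWaveMode L p) (modeAn L (planeWaveMode L q) Φ)) := fun q => by
    rw [modeAn_modeAn_planeWaveMode_comm q p hΦ.contDiff.continuous hΦ.symm]
  have h2 : ∀ q, normSq L (modeAn L (planeWaveMode L q) (modeCr (planeWaveMode L p) Φ)) =
      occ L q Φ + normSq L (modeAn L (planeWaveMode L p) (modeAn L (planeWaveMode L q) Φ)) +
        (if q = p then normSq L Φ + 2 * occ L p Φ else 0) := fun q =>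
    normSq_modeAn_modeCr_planeWaveMode hL q p hΦ
  have hsplit : ∑' q : Fin 3 → ℤ, eps L q * (occ L q Φ +
      normSq L (modeAn L (planeWaveMode L p) (modeAn L (planeWaveMode L q) Φ)) +
        (if q = p then normSq L Φ + 2 * occ L p Φ else 0)) =
      (∑' q : Fin 3 → ℤ, eps L q * occ L q Φ) +
        (∑' q : Fin 3 → ℤ, eps L q * normSq L (modeAn L (planeWaveMode L p) (modeAn L (planeWaveMode L q) Φ))) +
        eps L p * (normSq L Φ + 2 * occ L p Φ) := by
    rw [← tsum_eps_ite L p (normSq L Φ + 2 * occ L p Φ), ← ENNReal.tsum_add, ← ENNReal.tsum_add]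
    refine tsum_congr fun q => ?_
    ring
  simp only [h1, h2]
  rw [hsplit]
  simp only [occ]
  ring

/-! ### The kinetic cross term `Re B_0(Φ, n̂Φ)` through the modes -/

/-- `qform 0 = ∫|∇·|²`. [folklore] -/
theorem qform_zero_eq (L : ℝ) (f : Config M → ℂ) : qform 0 L f = ∫⁻ X in cellN M L, kineticDensity f X := by
  unfold qform
  refine lintegral_congr fun X => ?_
  rw [periodicInteraction_zero, zero_mul, add_zero]

/-- The kinetic energy of a `C¹` function on the cell is finite. [folklore] -/
theorem qform_zero_ne_top (L : ℝ) {f : Config M → ℂ} (hf : ContDiff ℝ 1 f) : qform 0 L f ≠ ⊤ := by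
  rw [qform_zero_eq, lintegral_kineticDensity_eq hf L]
  exact ENNReal.ofReal_ne_top

/-- Linearity of `a_q` along the real line `f + t g` (continuous `f, g`). [folklore] -/
theorem modeAn_add_real_smul (L : ℝ) (q : Fin 3 → ℤ) {f g : Config (m + 1) → ℂ} (hf : Continuous f) (hg : Continuous g) (t : ℝ) :
    modeAn L (planeWaveMode L q) (fun X => f X + (t : ℂ) * g X) =
      fun Y => modeAn L (planeWaveMode L q) f Y + (t : ℂ) * modeAn L (planeWaveMode L q) g Y := by
  have hslice : ∀ (h : Config (m + 1) → ℂ), Continuous h → ∀ Y : Config m,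
      IntegrableOn (fun x => conj (planeWaveMode L q x) * h (Matrix.vecCons x Y)) (cell L) volume := fun h hh Y =>
    integrableOn_cell ((Complex.continuous_conj.comp (continuous_planeWaveMode L q)).mul
      (hh.comp (continuous_id.matrixVecCons continuous_const)))
  have h1 : (fun X => f X + (t : ℂ) * g X) = f + (t : ℂ) • g := by funext X; simp [Pi.add_apply, Pi.smul_apply]
  have h2 : ∀ Y : Config m, IntegrableOn (fun x => conj (planeWaveMode L q x) * ((t : ℂ) • g) (Matrix.vecCons x Y)) (cell L) volume := by
    intro Y
    have := (hslice g hg Y).const_mul (t : ℂ)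
    refine this.congr (Eventually.of_forall fun x => ?_)
    simp only [Pi.smul_apply, smul_eq_mul]; ring
  rw [h1, modeAn_add L (planeWaveMode L q) f ((t : ℂ) • g) (hslice f hf) h2, modeAn_smul L (planeWaveMode L q)]
  funext Y; simp [Pi.add_apply, Pi.smul_apply]

/-- **Polarised kinetic Parseval**: `Re B_0(f, g) = ∑_q ε_q Re⟨a_q f, a_q g⟩` for core `(m+1)`-body `f, g`
(polarisation of K3 along `f ± g`, C1/C1'). [cite: LSSY2005, App. A (A.6)] -/
theorem formRe_zero_eq_tsum (hL : 0 < L) {f g : Config (m + 1) → ℂ} (hf : IsCore L f) (hg : IsCore L g) :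
    formRe 0 L f g = ∑' q : Fin 3 → ℤ, (eps L q).toReal *
      innerRe L (modeAn L (planeWaveMode L q) f) (modeAn L (planeWaveMode L q) g) := by
  -- notation
  set u : (Fin 3 → ℤ) → Config m → ℂ := fun q => modeAn L (planeWaveMode L q) f with hu
  set v : (Fin 3 → ℤ) → Config m → ℂ := fun q => modeAn L (planeWaveMode L q) g with hv
  have hfc := hf.contDiff.continuous
  have hgc := hg.contDiff.continuous
  have huc : ∀ q, Continuous (u q) := fun q => (isCore_modeAn hL q hf).contDiff.continuous
  have hvc : ∀ q, Continuous (v q) := fun q => (isCore_modeAn hL q hg).contDiff.continuous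
  -- kinetic energies along `f + t g`
  have hT : ∀ t : ℝ, qform 0 L (fun X => f X + (t : ℂ) * g X) =
      ∑' q, eps L q * normSq L (fun Y => u q Y + (t : ℂ) * v q Y) := by
    intro t
    rw [qform_zero_eq, lintegral_kineticDensity_eq_tsum_normSq_modeAn hL (isCore_add_smul hf hg t)]
    refine tsum_congr fun q => ?_
    rw [modeAn_add_real_smul L q hfc hgc t]
    rfl
  have hfin : ∀ t : ℝ, (∑' q, eps L q * normSq L (fun Y => u q Y + (t : ℂ) * v q Y)) ≠ ⊤ := fun t => by
    rw [← hT t]; exact qform_zero_ne_top L (isCore_add_smul hf hg t).contDiff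
  have hterm : ∀ (t : ℝ) q, eps L q * normSq L (fun Y => u q Y + (t : ℂ) * v q Y) ≠ ⊤ := fun t q =>
    ne_top_of_le_ne_top (hfin t) (ENNReal.le_tsum q)
  -- real form of the tsums
  have hreal : ∀ t : ℝ, (qform 0 L (fun X => f X + (t : ℂ) * g X)).toReal =
      ∑' q, (eps L q).toReal * ((normSq L (u q)).toReal + 2 * t * innerRe L (u q) (v q) + t ^ 2 * (normSq L (v q)).toReal) := by
    intro t
    rw [hT t, ENNReal.tsum_toReal_eq (hterm t)]
    refine tsum_congr fun q => ?_
    rw [ENNReal.toReal_mul, normSq_add_smul hL (huc q) (hvc q) t]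
  have hsum : ∀ t : ℝ, Summable fun q => (eps L q).toReal *
      ((normSq L (u q)).toReal + 2 * t * innerRe L (u q) (v q) + t ^ 2 * (normSq L (v q)).toReal) := by
    intro t
    have := ENNReal.summable_toReal (hfin t)
    refine this.congr fun q => ?_
    rw [ENNReal.toReal_mul, normSq_add_smul hL (huc q) (hvc q) t]
  -- polarisation: `t = 1` minus `t = -1`
  have hC1 : ∀ t : ℝ, (qform 0 L (fun X => f X + (t : ℂ) * g X)).toReal =
      (qform 0 L f).toReal + 2 * t * formRe 0 L f g + t ^ 2 * (qform 0 L g).toReal := fun t =>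
    qform_add_smul hL measurable_const hf hg (qform_zero_ne_top L hf.contDiff) (qform_zero_ne_top L hg.contDiff) t
  have key : 4 * formRe 0 L f g = ∑' q, (eps L q).toReal * (4 * innerRe L (u q) (v q)) := by
    have h1 := hC1 1
    have h2 := hC1 (-1)
    rw [hreal] at h1 h2
    have hdiff := (hsum 1).tsum_sub (hsum (-1))
    have hlhs : (∑' q, ((eps L q).toReal * ((normSq L (u q)).toReal + 2 * (1 : ℝ) * innerRe L (u q) (v q) +
        (1 : ℝ) ^ 2 * (normSq L (v q)).toReal) -
        (eps L q).toReal * ((normSq L (u q)).toReal + 2 * (-1 : ℝ) * innerRe L (u q) (v q) +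
        (-1 : ℝ) ^ 2 * (normSq L (v q)).toReal))) = ∑' q, (eps L q).toReal * (4 * innerRe L (u q) (v q)) :=
      tsum_congr fun q => by ring
    rw [← hlhs, hdiff]
    linarith
  have h4 : (∑' q, (eps L q).toReal * (4 * innerRe L (u q) (v q))) = 4 * ∑' q, (eps L q).toReal * innerRe L (u q) (v q) := by
    rw [← tsum_mul_left]
    exact tsum_congr fun q => by ring
  rw [h4] at key
  linarith

/-- The per-mode inner products `Re⟨a_q Φ, a_q n̂Φ⟩ = [q = p]‖a_pΦ‖² + ‖a_p a_q Φ‖²` for a core `(n+2)`-body `Φ`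
(CCR on `a_pΦ`, adjointness, `[a_p, a_q] = 0`). [folklore] -/
theorem innerRe_modeAn_numOp (hL : 0 < L) (q p : Fin 3 → ℤ) {Φ : Config (n + 2) → ℂ} (hΦ : IsCore L Φ) :
    innerRe L (modeAn L (planeWaveMode L q) Φ)
        (modeAn L (planeWaveMode L q) (modeCr (planeWaveMode L p) (modeAn L (planeWaveMode L p) Φ))) =
      (if q = p then (occ L p Φ).toReal else 0) +
        (normSq L (modeAn L (planeWaveMode L p) (modeAn L (planeWaveMode L q) Φ))).toReal := by
  have hpΦ : IsCore L (modeAn L (planeWaveMode L p) Φ) := isCore_modeAn hL p hΦ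
  have hqΦ : IsCore L (modeAn L (planeWaveMode L q) Φ) := isCore_modeAn hL q hΦ
  have hqp : Continuous (modeAn L (planeWaveMode L q) (modeAn L (planeWaveMode L p) Φ)) :=
    (isCore_modeAn hL q hpΦ).contDiff.continuous
  -- CCR on the core `a_p Φ`
  rw [modeAn_modeCr_planeWaveMode hL q p hpΦ.contDiff.continuous]
  unfold innerRe
  have hi1 : Integrable (fun Y => conj (modeAn L (planeWaveMode L q) Φ Y) *
      (if q = p then modeAn L (planeWaveMode L p) Φ Y else 0)) (volume.restrict (cellN (n + 1) L)) := by
    split_ifs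
    · exact integrableOn_cellN ((Complex.continuous_conj.comp hqΦ.contDiff.continuous).mul hpΦ.contDiff.continuous) L
    · simp
  have hi2 : Integrable (fun Y => conj (modeAn L (planeWaveMode L q) Φ Y) *
      modeCr (planeWaveMode L p) (modeAn L (planeWaveMode L q) (modeAn L (planeWaveMode L p) Φ)) Y)
      (volume.restrict (cellN (n + 1) L)) :=
    integrableOn_cellN ((Complex.continuous_conj.comp hqΦ.contDiff.continuous).mul
      (isCore_modeCr hL p (isCore_modeAn hL q hpΦ)).contDiff.continuous) L
  simp only [mul_add]
  rw [integral_add hi1 hi2, Complex.add_re]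
  congr 1
  · split_ifs with h
    · subst h
      rw [integral_conj_mul_self_eq L hqΦ.contDiff.continuous, Complex.ofReal_re]
      rfl
    · simp
  · -- adjointness then commutation
    rw [← integral_conj_modeAn_planeWaveMode_mul p hqp hqΦ.contDiff.continuous hqΦ.symm,
      modeAn_modeAn_planeWaveMode_comm q p hΦ.contDiff.continuous hΦ.symm,
      integral_conj_mul_self_eq L ((isCore_modeAn hL p hqΦ).contDiff.continuous), Complex.ofReal_re]

/-- The kinetic cross quantity `K = ε_p N_p(Φ) + ∑_q ε_q ‖a_p a_q Φ‖²` is finite (it is at most half of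
`T[a_pΦ] + T[a_p†Φ]`). [folklore] -/
theorem kinCrossENN_ne_top (hL : 0 < L) (p : Fin 3 → ℤ) {Φ : Config (n + 2) → ℂ} (hΦ : IsCore L Φ) :
    eps L p * occ L p Φ + ∑' q : Fin 3 → ℤ, eps L q * normSq L
        (modeAn L (planeWaveMode L p) (modeAn L (planeWaveMode L q) Φ)) ≠ ⊤ := by
  have h := kinetic_wagnerFeynman hL p hΦ
  have hfin : (∫⁻ Y in cellN (n + 1) L, kineticDensity (modeAn L (planeWaveMode L p) Φ) Y) +
      ∫⁻ Z in cellN (n + 3) L, kineticDensity (modeCr (planeWaveMode L p) Φ) Z ≠ ⊤ := by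
    rw [← qform_zero_eq, ← qform_zero_eq]
    exact ENNReal.add_ne_top.2 ⟨qform_zero_ne_top L (isCore_modeAn hL p hΦ).contDiff,
      qform_zero_ne_top L (isCore_modeCr hL p hΦ).contDiff⟩
  rw [h] at hfin
  intro htop
  apply hfin
  rw [htop]
  simp

/-- **The kinetic cross term through the modes**: `Re B_0(Φ, n̂Φ) = (ε_p N_p(Φ) + ∑_q ε_q ‖a_p a_q Φ‖²).toReal` for a core
`(n+2)`-body `Φ`, `n̂ = a_p† a_p`. [cite: LSSY2005, App. A (A.6)–(A.7)] -/
theorem formRe_zero_numOp (hL : 0 < L) (p : Fin 3 → ℤ) {Φ : Config (n + 2) → ℂ} (hΦ : IsCore L Φ) :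
    formRe 0 L Φ (modeCr (planeWaveMode L p) (modeAn L (planeWaveMode L p) Φ)) =
      (eps L p * occ L p Φ + ∑' q : Fin 3 → ℤ, eps L q * normSq L
        (modeAn L (planeWaveMode L p) (modeAn L (planeWaveMode L q) Φ))).toReal := by
  have hpΦ : IsCore L (modeAn L (planeWaveMode L p) Φ) := isCore_modeAn hL p hΦ
  have hN : IsCore L (modeCr (planeWaveMode L p) (modeAn L (planeWaveMode L p) Φ)) := isCore_modeCr hL p hpΦ
  rw [formRe_zero_eq_tsum hL hΦ hN]
  simp only [innerRe_modeAn_numOp hL _ p hΦ, mul_add]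
  have hK := kinCrossENN_ne_top hL p hΦ
  have hKsum : (∑' q : Fin 3 → ℤ, eps L q * normSq L (modeAn L (planeWaveMode L p) (modeAn L (planeWaveMode L q) Φ))) ≠ ⊤ :=
    fun h => hK (by rw [h]; simp)
  have hterm : ∀ q, eps L q * normSq L (modeAn L (planeWaveMode L p) (modeAn L (planeWaveMode L q) Φ)) ≠ ⊤ := fun q =>
    ne_top_of_le_ne_top hKsum (ENNReal.le_tsum q)
  have hocc : eps L p * occ L p Φ ≠ ⊤ := fun h => hK (by rw [h]; simp)
  -- split the real tsum
  have hs1 : Summable fun q : Fin 3 → ℤ => (eps L q).toReal * (if q = p then (occ L p Φ).toReal else 0) := by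
    refine summable_of_ne_finset_zero (s := {p}) fun q hq => ?_
    rw [Finset.mem_singleton] at hq
    simp [hq]
  have hs2 : Summable fun q : Fin 3 → ℤ => (eps L q).toReal *
      (normSq L (modeAn L (planeWaveMode L p) (modeAn L (planeWaveMode L q) Φ))).toReal := by
    have := ENNReal.summable_toReal hKsum
    refine this.congr fun q => ?_
    rw [ENNReal.toReal_mul]
  rw [hs1.tsum_add hs2, tsum_eq_single p (fun q hq => by simp [hq]), if_pos rfl,
    ENNReal.toReal_add hocc hKsum, ENNReal.toReal_mul, ENNReal.tsum_toReal_eq hterm]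
  congr 1
  exact tsum_congr fun q => by rw [ENNReal.toReal_mul]

end Summit.AtomisticToContinuum.BoseEinsteinCondensation.Cruxes.PeriodicIRBound.LinearPhFloorWagner.WF

end

namespace Summit.AtomisticToContinuum.BoseEinsteinCondensation.Cruxes.PeriodicIRBound.LinearPhFloorWagner

/-- The registered sub-goal `stub_wfHeartKin2` of the crux ledger: this file's headline lemma `WF.kinetic_wagnerFeynman`. -/
theorem stub_wfHeartKin2 : WF.Pkg.HeartKin2 :=
  @WF.kinetic_wagnerFeynman

end Summit.AtomisticToContinuum.BoseEinsteinCondensation.Cruxes.PeriodicIRBound.LinearPhFloorWagner
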